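import Literature.Geometry.DiscreteGeometry.TwoShellPatterns

/-!
# Goodness lifts from a sub-configuration (line `Sketch`, stub `stub_local`)

Support file for the crux `PhononSlackCertificates.FarFieldGapR` (stmt-AtomisticToContinuum-14969),
line `Sketch` (octahedral-poisoning collapse).  The line restricts a configuration
`x : Fin N → ℝ³` to a set `U = range e` of particles (`e : Fin n ↪ Fin N`, sub-configuration
`y := x ∘ e`); the glue needs that a particle `e k` of `U` which is GOOD in `y` and whose whole
`3/2`-neighbourhood (in `x`) lies inside `U` is good in `x` — contrapositively, the good-in-`y`
particles of an all-bad set `U` are `3/2`-boundary particles of `U`.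

PROOF.  From the witness `(a, A, P, f)` of `IsTwoShellGood (1/20) (47/50) 1 (x ∘ e) k` take
`(a, A, P, e ∘ f)` for `(x, e k)`: the matching clause is literally the same inequality;
`e (f v) ≠ e k` from `f v ≠ k` and injectivity of `e`; injectivity on `P` from that of `f` and of
`e`; covering: a particle `j ≠ e k` with `dist (x j) (x (e k)) ≤ 3a/2 ≤ 3/2` (`a ≤ 1`) lies in `U`
by hypothesis, `j = e k'` with `k' ≠ k`, so `k' = f v` for some `v ∈ P` and `e (f v) = j`.

Leans on the definition `IsTwoShellGood` (`Literature/Geometry/DiscreteGeometry/TwoShellPatterns.lean`,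
whose `IsTwoShellGood.comp_equiv` is the model) and Mathlib only.  No new definitions, no named facts.
-/

noncomputable section

open scoped BigOperators

namespace Summit.AtomisticToContinuum.Crystallization.Theorems.PhononSlackCertificatesFarFieldGapR

open Literature.Geometry.DiscreteGeometry

/-- **Goodness lifts from a sub-configuration.**  If particle `k` of the sub-configuration
`x ∘ e` (`e : Fin n ↪ Fin N`) is `1/20`-good on the window `[47/50, 1]`, and every particle of `x`
within distance `3/2` of `x (e k)` belongs to `range e`, then `e k` is `1/20`-good in `x` (same
scale, isometry and pattern; assignment `e ∘ f`). -/
theorem stub_local :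
    ∀ (N n : ℕ) (x : Fin N → EuclideanSpace ℝ (Fin 3)) (e : Fin n ↪ Fin N) (k : Fin n),
      (∀ j : Fin N, dist (x j) (x (e k)) ≤ 3 / 2 → j ∈ Set.range e) →
        IsTwoShellGood (1 / 20) (47 / 50) 1 (x ∘ e) k →
          IsTwoShellGood (1 / 20) (47 / 50) 1 x (e k) := by
  intro N n x e k hU h
  obtain ⟨a, ha₁, ha₂, A, P, f, hP, hf, hinj, hsurj⟩ := h
  refine ⟨a, ha₁, ha₂, A, P, fun v => e (f v), hP, fun v hv => ?_, ?_, fun j hj hd => ?_⟩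
  · -- matching clause: the same inequality, and `e (f v) ≠ e k` by injectivity of `e`
    exact ⟨fun heq => (hf v hv).1 (e.injective heq), (hf v hv).2⟩
  · -- injectivity on the pattern
    exact fun v hv w hw hvw => hinj hv hw (e.injective hvw)
  · -- covering: `j` lies within `3a/2 ≤ 3/2` of `x (e k)`, hence in `range e`
    have hd' : dist (x j) (x (e k)) ≤ 3 / 2 := hd.trans (by linarith)
    obtain ⟨k', rfl⟩ := hU j hd'
    have hk' : k' ≠ k := fun heq => hj (congrArg e heq)
    obtain ⟨v, hv, hfv⟩ := hsurj k' hk' hd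
    exact ⟨v, hv, congrArg e hfv⟩

end Summit.AtomisticToContinuum.Crystallization.Theorems.PhononSlackCertificatesFarFieldGapR

end
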